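import Mathlib

/-!
# The join count (generic): a weight of the join of per-part profiles, summed over all
configurations, is a Möbius-inverted sum of products of per-part counts

Parts `i : ι` with configuration types `Ω i`, profile maps `p i : Ω i → L` into a finite lattice
with a bottom, and a weight `w : L → ℤ` of the join.  Then
`∑ S, w (⨆ i, p i (S i)) = ∑ π, w̃ π * ∏ i, #{s : Ω i | p i s ≤ π}` with
`w̃ π = ∑ σ ≥ π, μ(π, σ) * w σ` (`sum_weight_sup_eq`): the count of configurations whose join is
`≤ π` factorises over the parts, and Möbius inversion on `L` recovers the exact join.  This is the
counting statement (iii) of the 4-terminal profile theorem, with `L` the profile lattice and `w` the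
type weight `o1 + o2 − BAD`; the universal coefficients are the `w̃ π`.
-/

namespace PercRepro

open Finset

variable {ι L : Type*} [Fintype ι] [DecidableEq ι] [Lattice L] [OrderBot L] [LocallyFiniteOrder L] [Fintype L]
  [DecidableEq L] [DecidableLE L] {Ω : ι → Type*} [∀ i, Fintype (Ω i)]

omit [LocallyFiniteOrder L] [Fintype L] [DecidableEq L] in
/-- The configurations whose join of profiles is `≤ π` are the products of the parts' configurations
with profile `≤ π`. -/
theorem card_filter_sup_le_eq_prod (p : ∀ i, Ω i → L) (π : L) :
    (univ.filter fun S : ∀ i, Ω i => (univ.sup fun i => p i (S i)) ≤ π).card =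
      ∏ i, (univ.filter fun s : Ω i => p i s ≤ π).card := by
  rw [← Fintype.card_piFinset]
  congr 1
  ext S
  simp [Fintype.mem_piFinset, Finset.sup_le_iff]

omit [Fintype L] in
/-- The count of configurations with join `≤ π` is the sum over `σ ≤ π` of the counts with join
exactly `σ`. -/
theorem card_filter_sup_le_eq_sum (p : ∀ i, Ω i → L) (π : L) :
    (univ.filter fun S : ∀ i, Ω i => (univ.sup fun i => p i (S i)) ≤ π).card =
      ∑ σ ∈ Iic π, (univ.filter fun S : ∀ i, Ω i => (univ.sup fun i => p i (S i)) = σ).card := by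
  rw [card_eq_sum_card_fiberwise (f := fun S : ∀ i, Ω i => univ.sup fun i => p i (S i))
    (t := Iic π) (fun S hS => by simpa using hS)]
  refine Finset.sum_congr rfl fun σ hσ => ?_
  congr 1
  ext S
  simp only [mem_filter, mem_univ, true_and, and_iff_right_iff_imp]
  rintro rfl
  exact mem_Iic.1 hσ

/-- **The join count.** -/
theorem sum_weight_sup_eq (p : ∀ i, Ω i → L) (w : L → ℤ) :
    (∑ S : ∀ i, Ω i, w (univ.sup fun i => p i (S i))) =
      ∑ π : L, (∑ σ ∈ univ.filter (π ≤ ·), IncidenceAlgebra.mu ℤ π σ * w σ) *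
        ∏ i, ((univ.filter fun s : Ω i => p i s ≤ π).card : ℤ) := by
  -- the exact counts `F` and the cumulative counts `N`
  set F : L → ℤ := fun σ => ((univ.filter fun S : ∀ i, Ω i => (univ.sup fun i => p i (S i)) = σ).card : ℤ)
    with hF
  set N : L → ℤ := fun π => ((univ.filter fun S : ∀ i, Ω i => (univ.sup fun i => p i (S i)) ≤ π).card : ℤ)
    with hN
  have hNF : ∀ π, N π = ∑ σ ∈ Iic π, F σ := by
    intro π
    simp only [hN, hF, card_filter_sup_le_eq_sum p π]
    push_cast
    rfl
  -- Möbius inversion: `F π = ∑ σ ≤ π, μ(σ, π) N σ`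
  have hmu : ∀ π, F π = ∑ σ ∈ Iic π, IncidenceAlgebra.mu ℤ σ π * N σ :=
    IncidenceAlgebra.moebius_inversion_bot F N hNF
  -- the left-hand side is `∑ π, F π * w π`
  have hlhs : (∑ S : ∀ i, Ω i, w (univ.sup fun i => p i (S i))) = ∑ π : L, F π * w π := by
    rw [← Finset.sum_fiberwise_of_maps_to (s := univ) (t := univ)
      (g := fun S : ∀ i, Ω i => univ.sup fun i => p i (S i)) (fun _ _ => mem_univ _)]
    refine Finset.sum_congr rfl fun π _ => ?_
    rw [Finset.sum_congr rfl (g := fun _ => w π) fun S hS => by rw [(mem_filter.1 hS).2],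
      Finset.sum_const, nsmul_eq_mul]
  rw [hlhs]
  -- substitute the inversion and exchange the two sums
  calc ∑ π : L, F π * w π
      = ∑ π : L, ∑ σ ∈ Iic π, IncidenceAlgebra.mu ℤ σ π * N σ * w π := by
        refine Finset.sum_congr rfl fun π _ => ?_
        rw [hmu π, Finset.sum_mul]
    _ = ∑ σ : L, ∑ π ∈ univ.filter (σ ≤ ·), IncidenceAlgebra.mu ℤ σ π * N σ * w π := by
        refine Finset.sum_comm' fun π σ => ?_
        simp only [mem_univ, true_and, mem_Iic, mem_filter, and_true]
    _ = ∑ σ : L, (∑ π ∈ univ.filter (σ ≤ ·), IncidenceAlgebra.mu ℤ σ π * w π) * N σ := by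
        refine Finset.sum_congr rfl fun σ _ => ?_
        rw [Finset.sum_mul]
        refine Finset.sum_congr rfl fun π _ => ?_
        ring
    _ = ∑ π : L, (∑ σ ∈ univ.filter (π ≤ ·), IncidenceAlgebra.mu ℤ π σ * w σ) *
          ∏ i, ((univ.filter fun s : Ω i => p i s ≤ π).card : ℤ) := by
        refine Finset.sum_congr rfl fun π _ => ?_
        simp only [hN, card_filter_sup_le_eq_prod p π]
        push_cast
        rfl

end PercRepro
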